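import Summits.KontsevichZagierPeriods.KontsevichZagierPeriods.Theses.LiouvilleUnfolding
import Literature.NumberTheory.Transcendental.KZKernelConjectureForms
import Summits.KontsevichZagierPeriods.KontsevichZagierPeriods.Theorems.LiouvilleUnfoldingLogPrimitiveNL

/-!
# `LogKernelConjecture` (stmt-KontsevichZagierPeriods-2837) is the Kontsevich–Zagier period conjecture

Census theorem for the crux `LiouvilleUnfolding.LogKernelConjecture` ("the period conjecture for the
FIVE-rule calculus": `ker KZ.eval ⊆ R` for every subgroup `R ≥ KZ.relations` closed under the
logarithmic Newton–Leibniz rule). Now that the sibling crux `LogPrimitiveNL`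
(stmt-KontsevichZagierPeriods-2836) is a tree theorem
(`Summit.KontsevichZagierPeriods.LiouvilleUnfolding.LogPrimitiveNL.LogPrimitiveNL_of`: the logarithmic
rule is a DERIVED move of Kontsevich–Zagier's four rules), the subgroup `R := KZ.relations` satisfies
both hypotheses of the crux, so the crux implies — and is trivially implied by — the kernel form of
Conjecture 1, `Literature.NumberTheory.Transcendental.KZKernelConjecture`; by the Literature
comparison `kzKernelConjecture_iff_isRational` it is therefore equivalent to the summit statement
`KontsevichZagierPeriods` itself:

* `logKernelConjecture_iff_kzKernelConjecture : LogKernelConjecture ↔ KZKernelConjecture`;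
* `logKernelConjecture_iff_summit : LogKernelConjecture ↔ KontsevichZagierPeriods`.

Consequence for the line protocol: every line on this crux is a line on the summit; each of its stub
sets implies `KontsevichZagierPeriods`. No statement is changed and no definition is added.

References: M. Kontsevich, D. Zagier, *Periods* (2001), §1.2 Conjecture 1; A. Huber,
S. Müller-Stach, *Periods and Nori Motives* (2017), Conj. 13.2.1.
-/

noncomputable section

namespace Summit.KontsevichZagierPeriods.LiouvilleUnfolding.SpectatorLocalisation

open Literature.NumberTheory.Transcendental
open Summit.KontsevichZagierPeriods.KontsevichZagierPeriods.Theses.LiouvilleUnfolding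
  (LogKernelConjecture LogPrimitiveNL)

/-- **The five-rule period conjecture is the four-rule one.** `LogKernelConjecture ↔ KZKernelConjecture`:
`→` at `R := KZ.relations`, admissible because the logarithmic Newton–Leibniz rule is derivable
(`LogPrimitiveNL_of`, stmt-2836); `←` from `KZ.relations ≤ R`.
[Kontsevich–Zagier 2001, §1.2 Conjecture 1] [folklore] -/
theorem logKernelConjecture_iff_kzKernelConjecture : Summit.KontsevichZagierPeriods.KontsevichZagierPeriods.Theses.LiouvilleUnfolding.LogKernelConjecture ↔ Literature.NumberTheory.Transcendental.KZKernelConjecture :=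
  ⟨fun h c hc => h KZ.relations le_rfl LogPrimitiveNL.LogPrimitiveNL_of c hc,
    fun hK _ hR _ c hc => hR (hK c hc)⟩

/-- **The crux is the summit.** `LogKernelConjecture ↔ KontsevichZagierPeriods`, composing with the
Literature comparison `kzKernelConjecture_iff_isRational` (kernel form ⇔ KZ-literal two-representation
form, whose right-hand side is the body of `KontsevichZagierPeriods`).
[Kontsevich–Zagier 2001, §1.2 Conjecture 1; Huber–Müller-Stach 2017, Conj. 13.2.1] [folklore] -/
theorem logKernelConjecture_iff_summit : Summit.KontsevichZagierPeriods.KontsevichZagierPeriods.Theses.LiouvilleUnfolding.LogKernelConjecture ↔ KontsevichZagierPeriods :=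
  logKernelConjecture_iff_kzKernelConjecture.trans kzKernelConjecture_iff_isRational

end Summit.KontsevichZagierPeriods.LiouvilleUnfolding.SpectatorLocalisation
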